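import Summits.QuantumFields.BalabanUV.Beta.GAN24.DressedStepFaceCharges
import Summits.QuantumFields.BalabanUV.Beta.GAN24.WilsonFaceHalfVertex

/-!
# `BalabanUV.Beta.GAN24.DressedWilsonHalfVertex` — binder row G-an2-4 ∕ (CONV-C), W-slot CT-W, conservation law (C)∕(C)sym, steps (E2) ∕ (E4) of this lineage's note
# `HOME/b2b-balaban-gan24-formalise-leaf-04/g65/CSYM-LEVEL0-KERNEL-BLUEPRINT.md` §4: **THE BACKGROUND-RESUMMED DRESSED WILSON HALF-VERTEX IS THE EDGE CURRENT** —
# `Σ_u Σ'_y 𝟙f(y_α)·vertexOfK X̃♮_j Lc S^E μ u y z (inl α)(inl a) = (Lc s_m s_f σ_j)·((s_f s_m)⁻¹ s_f⁻² cE)·(−½·curvAdj F_{μα} a z)` (face weight on the FIRST leg) and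
# `… (+½·curvAdj F_{μα} b y)` (face weight on the SECOND leg), `F_{μα} = 𝟙f ⊗ 𝟙f` on `(μ,α)`-plaquettes, `X̃♮_j = unitK s_f s_m (coDressKBmAt ρ Lc (KInvStep Lc j))`,
# `S^E = unitS s_f s_m (cE • wilsonA)` — the junction of `GAN24.DressedStepFaceCharges` (the dressed column charge `Lc·𝟙f·σ_j`) with `GAN24.WilsonFaceHalfVertex` (the
# biweighted pair sum of an3's table = `∓½·curvAdj`); every sum is FINITE by ultra-locality — no Fubini majorant

NOT IN PRINT; OUR BOOKKEEPING ([folklore] finite-support bookkeeping BY NAME over an2's `OneStepKernelFamily.vertexOfK ∕ colH ∕ wsum`, leaf-19's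
`WilsonVertexTwoConst.unitS_inl_inl ∕ wilsonA_eq_zero_of_table_right ∕ _left ∕ mem_biUnion_of_wilsonA_ne_zero_left ∕ _right`, leaf-15's `WilsonVertexSumZero.suppW ∕ wilsonA_eq_zero_left ∕
_right`, and the siblings `DressedStepFaceCharges.hasSum_dressedStep_col`, `WilsonFaceHalfVertex.hasSum_biweighted_wilsonA_curvAdj ∕ _snd`; G-an2-4 formalisation swarm, leaf prover
`b2b-balaban-gan24-formalise-leaf-04`, gen 65).  HONEST FRAMING (cell contract, verbatim): «discharging `BetaPertH` makes Bałaban's UV stability UNCONDITIONAL — a real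
constructive-QFT result; it is NOT the continuum limit and NOT the Clay problem.»  HONEST DEPENDENCY (verbatim): «continuum YM on T⁴ ⇐ BetaPertH ∧ nine spine estimates
(0/9 proved); BetaPertH ⇐ (D1) ∧ (D4) ∧ CAP+tail; G-an2-4 gates asym, D1 and NE2/3/4.»

WHY (blueprint §4): in the EE exchange word `Σ_{u∈cell} Σ'_{u′} FF[(dM_{(μ,u)} ∘ X̃♮) ∘ dM_{(ν,u′)}]` of the dressed one-step source both background bonds feed the cubic Wilson table
through the dressed `ℋ`-columns and both outer legs carry exit-face weights; resummed over its background bond, each half-vertex is a block-periodic CURRENT `∓½·curvAdj (𝟙f ⊗ 𝟙f)`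
(units aside).  These two `HasSum` families are the `j_u` of `GAN24.CovariantFamilyCellPairing` (first slot, `u ∈ cell`: regrouped to `⟨J, ·⟩_cell`) and the `J′` fed to
`GAN24.DressedKernelOnCurrent` (second slot, summed over the lattice) — whence `GAN24.PeriodicKKTExchangePairing.card_mul_pairing_plaq`.

WHAT ([folklore]; 0 `def`, 0 cited facts, 0 `def … : Prop`, 0 sorry): §1 **`vertexOfK_wilson_inl_inl`** ∕ **`vertexOfK_wilson_inl_inl'`** (any kernel `X`: the ff entry of
`vertexOfK X N (unitS s_f s_m (cE • wilsonA)) μ u y z` is `(s_f s_m)⁻¹ s_f⁻² cE·Σ_κ Σ_{t ∈ window} colH X N μ u κ t·wilsonA d κ t y z (inl α)(inl a)`, window `z − box1` ∕ `y − box1`);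
§2 (in-block root, `1 ≤ Lc`, every `j`, all units, `μ ≠ α`) **`hasSum_faceHalfVertex_fst`** (face weight on the first leg: value `…·(−½·curvAdj F_{μα} a z)`),
**`hasSum_faceHalfVertex_snd`** (face weight on the second leg: value `…·(+½·curvAdj F_{μα} b y)`).  Asserts NO value of Bałaban's tables beyond an3's DEFINED stencil; discharges
NOTHING of (C)sym ∕ (Q-D) ∕ (Q-D-rate) ∕ «T2Shape» ∕ «T2Drift» ∕ (hW, hWall); NEVER «G-an2-4 closed» as (CONV-C); NOT D1, NOT `BetaPertH`, NOT continuum, NOT Clay.  2026-08-22; no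
existing file touched.
-/

noncomputable section

open Finset
open scoped BigOperators
open Literature.MathematicalPhysics.QuantumFieldTheory
open Literature.MathematicalPhysics.QuantumFieldTheory.Balaban1983to89
open Literature.MathematicalPhysics.QuantumFieldTheory.Balaban1983to89.Beta
open ExpKernelCalculus (Site MKer)
open OneStepResolventKernel (Fib wsum)
open OneStepKernelFamily (KInvStep colH vertexOfK)
open StepJetData (wilsonA)
open BalabanStepJets (box1)
open AffineAveraging (box toSite curvAdj)
open Summit.QuantumFields.BalabanUV.Beta.AxialDressingRooted (coDressKBmAt)
open Summit.QuantumFields.BalabanUV.Beta.HessKerDressedUnits (unitK unitS)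
open Summit.QuantumFields.BalabanUV.Beta.GAN24.WilsonVertexSumZero (suppW wilsonA_eq_zero_left wilsonA_eq_zero_right)
open Summit.QuantumFields.BalabanUV.Beta.GAN24.WilsonVertexTwoConst (unitS_inl_inl wilsonA_eq_zero_of_table_right wilsonA_eq_zero_of_table_left
  mem_biUnion_of_wilsonA_ne_zero_left mem_biUnion_of_wilsonA_ne_zero_right)
open Summit.QuantumFields.BalabanUV.Beta.GAN24.DressedStepFaceCharges (hasSum_dressedStep_col)
open Summit.QuantumFields.BalabanUV.Beta.GAN24.WilsonFaceHalfVertex (hasSum_biweighted_wilsonA_curvAdj hasSum_biweighted_wilsonA_snd)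

namespace Summit.QuantumFields.BalabanUV.Beta.GAN24.DressedWilsonHalfVertex

variable {d : ℕ}

/-! ## §1 The chain-rule vertex on the Wilson table is a finite window sum -/

/-- [folklore] **THE CHAIN-RULE VERTEX ON THE (UNIT-DRESSED) WILSON TABLE, ff ENTRY, AS A FINITE WINDOW SUM AROUND THE SECOND LEG**: for ANY kernel `X`,
`vertexOfK X N (unitS s_f s_m (cE • wilsonA)) μ u y z (inl α) (inl a) = (s_f s_m)⁻¹·s_f⁻²·cE · Σ_κ Σ_{t ∈ z − box1} colH X N μ u κ t · wilsonA d κ t y z (inl α) (inl a)`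
(`WilsonVertexTwoConst.wilsonA_eq_zero_of_table_right`). -/
theorem vertexOfK_wilson_inl_inl (X : MKer (d + 1) (Fib d)) (N : ℕ) (sf sm cE : ℝ) (μ : Fin (d + 1)) (u y z : Site (d + 1)) (α a : Fin (d + 1)) :
    vertexOfK X N (unitS sf sm (fun κ v => cE • wilsonA d κ v)) μ u y z (Sum.inl α) (Sum.inl a) =
      (sf * sm)⁻¹ * (sf⁻¹ * sf⁻¹) * cE * ∑ κ : Fin (d + 1), ∑ t ∈ (box1 (d + 1)).image (fun v => z - v),
        colH X N μ u κ t * wilsonA d κ t y z (Sum.inl α) (Sum.inl a) := by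
  simp only [vertexOfK, wsum, unitS_inl_inl, Pi.smul_apply, smul_eq_mul]
  rw [Finset.mul_sum]
  refine Finset.sum_congr rfl fun κ _ => ?_
  rw [tsum_eq_sum (s := (box1 (d + 1)).image (fun v => z - v)) (fun t ht => by
    rw [wilsonA_eq_zero_of_table_right κ y ht α a]; ring), Finset.mul_sum]
  exact Finset.sum_congr rfl fun t _ => by ring

/-- [folklore] **… AS A FINITE WINDOW SUM AROUND THE FIRST LEG** (`WilsonVertexTwoConst.wilsonA_eq_zero_of_table_left`). -/
theorem vertexOfK_wilson_inl_inl' (X : MKer (d + 1) (Fib d)) (N : ℕ) (sf sm cE : ℝ) (μ : Fin (d + 1)) (u y z : Site (d + 1)) (α a : Fin (d + 1)) :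
    vertexOfK X N (unitS sf sm (fun κ v => cE • wilsonA d κ v)) μ u y z (Sum.inl α) (Sum.inl a) =
      (sf * sm)⁻¹ * (sf⁻¹ * sf⁻¹) * cE * ∑ κ : Fin (d + 1), ∑ t ∈ (box1 (d + 1)).image (fun v => y - v),
        colH X N μ u κ t * wilsonA d κ t y z (Sum.inl α) (Sum.inl a) := by
  simp only [vertexOfK, wsum, unitS_inl_inl, Pi.smul_apply, smul_eq_mul]
  rw [Finset.mul_sum]
  refine Finset.sum_congr rfl fun κ _ => ?_
  rw [tsum_eq_sum (s := (box1 (d + 1)).image (fun v => y - v)) (fun t ht => by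
    rw [wilsonA_eq_zero_of_table_left κ ht z α a]; ring), Finset.mul_sum]
  exact Finset.sum_congr rfl fun t _ => by ring

/-! ## §2 The face-weighted half-vertices resummed over the background bond through the dressed step kernel -/

section Resummed

variable {Lc : ℕ} [NeZero Lc] {r : Fin (d + 1) → ℕ} {μ α : Fin (d + 1)} (hμα : μ ≠ α)
include hμα

/-- [folklore] **THE BACKGROUND-RESUMMED DRESSED WILSON HALF-VERTEX, FACE WEIGHT ON THE FIRST LEG, IS `−½·c·curvAdj (𝟙f ⊗ 𝟙f)`** (in-block root `ρ = toSite r`,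
`1 ≤ Lc`, every level `j`, all units, `μ ≠ α`; blueprint §4 (E4)): with `X̃♮_j = unitK s_f s_m (coDressKBmAt ρ Lc (KInvStep Lc j))`, `S^E = unitS s_f s_m (cE • wilsonA)` and
`𝟙f(n) := [n % Lc = Lc − 1]`, the family `u ↦ Σ'_y 𝟙f(y_α)·vertexOfK X̃♮_j Lc S^E μ u y z (inl α) (inl a)` (the left half-vertex sourced by the background bond `(μ, u)`, read on
its first leg at the `α`-exit face, second leg `(a, z)` free) has the `HasSum` `(Lc·s_m s_f·σ_j)·((s_f s_m)⁻¹ s_f⁻² cE)·(−½·curvAdj F_{μα} a z)`, `F_{μα} = 𝟙f ⊗ 𝟙f` on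
`(μ,α)`-plaquettes — every sum is FINITE by the ultra-locality of an3's table (`DressedStepFaceCharges.hasSum_dressedStep_col` + `WilsonFaceHalfVertex.hasSum_biweighted_wilsonA_curvAdj`). -/
theorem hasSum_faceHalfVertex_fst (hLc : 1 ≤ Lc) (hr : r ∈ box (d + 1) Lc) (sf sm cE : ℝ) (j : ℕ) (a : Fin (d + 1)) (z : Site (d + 1)) :
    HasSum (fun u : Site (d + 1) => ∑' y : Site (d + 1), (if y α % (Lc : ℤ) = (Lc : ℤ) - 1 then (1 : ℝ) else 0) *
        vertexOfK (unitK sf sm (coDressKBmAt (toSite r) Lc (KInvStep (d := d) Lc j))) Lc (unitS sf sm (fun κ v => cE • wilsonA d κ v)) μ u y z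
          (Sum.inl α) (Sum.inl a))
      ((((Lc : ℝ) * (sm * sf)) * ((((Lc ^ (j + 1) : ℕ) : ℝ)) ^ (d + 1 + 1))⁻¹) * ((sf * sm)⁻¹ * (sf⁻¹ * sf⁻¹) * cE) *
        (-(1 / 2 : ℝ) * curvAdj (fun κ l (x : Site (d + 1)) =>
          (if κ = μ ∧ l = α then (if x μ % (Lc : ℤ) = (Lc : ℤ) - 1 then (1 : ℝ) else 0) * (if x α % (Lc : ℤ) = (Lc : ℤ) - 1 then (1 : ℝ) else 0) else 0) -
          (if κ = α ∧ l = μ then (if x μ % (Lc : ℤ) = (Lc : ℤ) - 1 then (1 : ℝ) else 0) * (if x α % (Lc : ℤ) = (Lc : ℤ) - 1 then (1 : ℝ) else 0) else 0)) a z)) := by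
  classical
  set X := unitK sf sm (coDressKBmAt (toSite r) Lc (KInvStep (d := d) Lc j)) with hX
  set p : ℤ → ℝ := fun n => if n % (Lc : ℤ) = (Lc : ℤ) - 1 then (1 : ℝ) else 0 with hp
  set U : Finset (Site (d + 1)) := (box1 (d + 1)).image (fun v => z - v) with hU
  set c : ℝ := (sf * sm)⁻¹ * (sf⁻¹ * sf⁻¹) * cE with hc
  show HasSum (fun u : Site (d + 1) => ∑' y : Site (d + 1), p (y α) * vertexOfK X Lc (unitS sf sm (fun κ v => cE • wilsonA d κ v)) μ u y z (Sum.inl α) (Sum.inl a))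
    ((((Lc : ℝ) * (sm * sf)) * ((((Lc ^ (j + 1) : ℕ) : ℝ)) ^ (d + 1 + 1))⁻¹) * c *
      (-(1 / 2 : ℝ) * curvAdj (fun κ l (x : Site (d + 1)) =>
        (if κ = μ ∧ l = α then p (x μ) * p (x α) else 0) - (if κ = α ∧ l = μ then p (x μ) * p (x α) else 0)) a z))
  -- the `y`-weighted table entry at a window site `t`, as a finite sum
  set W : Fin (d + 1) → Site (d + 1) → ℝ := fun κ t => ∑ y ∈ U.biUnion (suppW κ), p (y α) * wilsonA d κ t y z (Sum.inl α) (Sum.inl a) with hW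
  have hWt : ∀ κ, ∀ t ∈ U, (∑' y : Site (d + 1), p (y α) * wilsonA d κ t y z (Sum.inl α) (Sum.inl a)) = W κ t := by
    intro κ t ht
    refine tsum_eq_sum fun y hy => ?_
    have hy' : y ∉ suppW κ t := fun h => hy (Finset.mem_biUnion.2 ⟨t, ht, h⟩)
    rw [wilsonA_eq_zero_left κ t hy' z α a, mul_zero]
  -- step 1: the `y`-sum of the face-weighted vertex, pointwise in `u`
  have step1 : ∀ u, (∑' y : Site (d + 1), p (y α) * vertexOfK X Lc (unitS sf sm (fun κ v => cE • wilsonA d κ v)) μ u y z (Sum.inl α) (Sum.inl a)) =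
      c * ∑ κ : Fin (d + 1), ∑ t ∈ U, colH X Lc μ u κ t * W κ t := by
    intro u
    have e : ∀ y, p (y α) * vertexOfK X Lc (unitS sf sm (fun κ v => cE • wilsonA d κ v)) μ u y z (Sum.inl α) (Sum.inl a) =
        ∑ κ : Fin (d + 1), ∑ t ∈ U, c * colH X Lc μ u κ t * (p (y α) * wilsonA d κ t y z (Sum.inl α) (Sum.inl a)) := by
      intro y
      rw [vertexOfK_wilson_inl_inl, Finset.mul_sum, Finset.mul_sum]
      refine Finset.sum_congr rfl fun κ _ => ?_
      rw [Finset.mul_sum, Finset.mul_sum]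
      exact Finset.sum_congr rfl fun t _ => by ring
    have hs : ∀ κ, ∀ t, Summable fun y : Site (d + 1) => c * colH X Lc μ u κ t * (p (y α) * wilsonA d κ t y z (Sum.inl α) (Sum.inl a)) := by
      intro κ t
      refine summable_of_ne_finset_zero (s := suppW κ t) fun y hy => ?_
      rw [wilsonA_eq_zero_left κ t hy z α a]; ring
    rw [tsum_congr e, Summable.tsum_finsetSum (fun κ _ => summable_sum fun t _ => hs κ t), Finset.mul_sum]
    refine Finset.sum_congr rfl fun κ _ => ?_
    rw [Summable.tsum_finsetSum (fun t _ => hs κ t), Finset.mul_sum]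
    refine Finset.sum_congr rfl fun t ht => ?_
    rw [tsum_mul_left, hWt κ t ht]
    ring
  simp_rw [step1]
  -- step 2: sum over the background bond `u` through the dressed column charge
  have step2 : HasSum (fun u : Site (d + 1) => c * ∑ κ : Fin (d + 1), ∑ t ∈ U, colH X Lc μ u κ t * W κ t)
      (c * ∑ κ : Fin (d + 1), ∑ t ∈ U, (if t κ % (Lc : ℤ) = (Lc : ℤ) - 1 then ((Lc : ℝ) * (sm * sf)) *
        (if κ = μ then ((((Lc ^ (j + 1) : ℕ) : ℝ)) ^ (d + 1 + 1))⁻¹ else 0) else 0) * W κ t) := by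
    refine HasSum.mul_left c (hasSum_sum fun κ _ => hasSum_sum fun t _ => ?_)
    exact (hasSum_dressedStep_col (d := d) hLc hr sf sm j μ (Sum.inl κ) t).mul_right (W κ t)
  convert step2 using 1
  -- step 3: only `κ = μ` survives; the finite double sum is the pair `HasSum` of `WilsonFaceHalfVertex`
  rw [Finset.sum_eq_single μ (fun κ _ hκ => Finset.sum_eq_zero fun t _ => by rw [if_neg hκ]; simp) (fun h => absurd (Finset.mem_univ μ) h)]
  simp only [if_true]
  have hval : ∑ t ∈ U, p (t μ) * W μ t = -(1 / 2 : ℝ) * curvAdj (fun κ l (x : Site (d + 1)) =>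
      (if κ = μ ∧ l = α then p (x μ) * p (x α) else 0) - (if κ = α ∧ l = μ then p (x μ) * p (x α) else 0)) a z := by
    have h7 := hasSum_biweighted_wilsonA_curvAdj (d := d) hμα p p a z
    have hz : ∀ tw ∉ U ×ˢ U.biUnion (suppW μ), p (tw.1 μ) * p (tw.2 α) * wilsonA d μ tw.1 tw.2 z (Sum.inl α) (Sum.inl a) = 0 := by
      intro tw htw
      by_contra hne
      exact htw (Finset.mem_product.2 (mem_biUnion_of_wilsonA_ne_zero_left μ (right_ne_zero_of_mul hne)))
    rw [← (hasSum_sum_of_ne_finset_zero hz).unique h7, Finset.sum_product]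
    refine Finset.sum_congr rfl fun t _ => ?_
    rw [hW, Finset.mul_sum]
    exact Finset.sum_congr rfl fun y _ => by ring
  have e3 : ∀ t ∈ U, (if t μ % (Lc : ℤ) = (Lc : ℤ) - 1 then ((Lc : ℝ) * (sm * sf)) * ((((Lc ^ (j + 1) : ℕ) : ℝ)) ^ (d + 1 + 1))⁻¹ else 0) * W μ t =
      (((Lc : ℝ) * (sm * sf)) * ((((Lc ^ (j + 1) : ℕ) : ℝ)) ^ (d + 1 + 1))⁻¹) * (p (t μ) * W μ t) := by
    intro t _
    simp only [hp]
    split_ifs <;> ring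
  rw [Finset.sum_congr rfl e3, ← Finset.mul_sum, hval]
  ring


/-- [folklore] **THE BACKGROUND-RESUMMED DRESSED WILSON HALF-VERTEX, FACE WEIGHT ON THE SECOND LEG, IS `+½·c·curvAdj (𝟙f ⊗ 𝟙f)`** (blueprint §4 (E2); same data, the face
weight `𝟙f(w_α)` now on the SECOND leg `w`, the first leg `(b, y)` free): the family `u ↦ Σ'_w 𝟙f(w_α)·vertexOfK X̃♮_j Lc S^E μ u y w (inl b) (inl α)` has the `HasSum`
`(Lc·s_m s_f·σ_j)·((s_f s_m)⁻¹ s_f⁻² cE)·(+½·curvAdj F_{μα} b y)` — the OPPOSITE sign (leg antisymmetry of an3's table: `WilsonFaceHalfVertex.hasSum_biweighted_wilsonA_snd`), the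
«`tR = −tL`» of note g64 §3 (c). -/
theorem hasSum_faceHalfVertex_snd (hLc : 1 ≤ Lc) (hr : r ∈ box (d + 1) Lc) (sf sm cE : ℝ) (j : ℕ) (b : Fin (d + 1)) (y : Site (d + 1)) :
    HasSum (fun u : Site (d + 1) => ∑' w : Site (d + 1), (if w α % (Lc : ℤ) = (Lc : ℤ) - 1 then (1 : ℝ) else 0) *
        vertexOfK (unitK sf sm (coDressKBmAt (toSite r) Lc (KInvStep (d := d) Lc j))) Lc (unitS sf sm (fun κ v => cE • wilsonA d κ v)) μ u y w
          (Sum.inl b) (Sum.inl α))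
      ((((Lc : ℝ) * (sm * sf)) * ((((Lc ^ (j + 1) : ℕ) : ℝ)) ^ (d + 1 + 1))⁻¹) * ((sf * sm)⁻¹ * (sf⁻¹ * sf⁻¹) * cE) *
        ((1 / 2 : ℝ) * curvAdj (fun κ l (x : Site (d + 1)) =>
          (if κ = μ ∧ l = α then (if x μ % (Lc : ℤ) = (Lc : ℤ) - 1 then (1 : ℝ) else 0) * (if x α % (Lc : ℤ) = (Lc : ℤ) - 1 then (1 : ℝ) else 0) else 0) -
          (if κ = α ∧ l = μ then (if x μ % (Lc : ℤ) = (Lc : ℤ) - 1 then (1 : ℝ) else 0) * (if x α % (Lc : ℤ) = (Lc : ℤ) - 1 then (1 : ℝ) else 0) else 0)) b y)) := by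
  classical
  set X := unitK sf sm (coDressKBmAt (toSite r) Lc (KInvStep (d := d) Lc j)) with hX
  set p : ℤ → ℝ := fun n => if n % (Lc : ℤ) = (Lc : ℤ) - 1 then (1 : ℝ) else 0 with hp
  set U : Finset (Site (d + 1)) := (box1 (d + 1)).image (fun v => y - v) with hU
  set c : ℝ := (sf * sm)⁻¹ * (sf⁻¹ * sf⁻¹) * cE with hc
  show HasSum (fun u : Site (d + 1) => ∑' w : Site (d + 1), p (w α) * vertexOfK X Lc (unitS sf sm (fun κ v => cE • wilsonA d κ v)) μ u y w (Sum.inl b) (Sum.inl α))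
    ((((Lc : ℝ) * (sm * sf)) * ((((Lc ^ (j + 1) : ℕ) : ℝ)) ^ (d + 1 + 1))⁻¹) * c *
      ((1 / 2 : ℝ) * curvAdj (fun κ l (x : Site (d + 1)) =>
        (if κ = μ ∧ l = α then p (x μ) * p (x α) else 0) - (if κ = α ∧ l = μ then p (x μ) * p (x α) else 0)) b y))
  set W : Fin (d + 1) → Site (d + 1) → ℝ := fun κ t => ∑ w ∈ U.biUnion (suppW κ), p (w α) * wilsonA d κ t y w (Sum.inl b) (Sum.inl α) with hW
  have hWt : ∀ κ, ∀ t ∈ U, (∑' w : Site (d + 1), p (w α) * wilsonA d κ t y w (Sum.inl b) (Sum.inl α)) = W κ t := by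
    intro κ t ht
    refine tsum_eq_sum fun w hw => ?_
    have hw' : w ∉ suppW κ t := fun h => hw (Finset.mem_biUnion.2 ⟨t, ht, h⟩)
    rw [wilsonA_eq_zero_right κ t y hw' b α, mul_zero]
  have step1 : ∀ u, (∑' w : Site (d + 1), p (w α) * vertexOfK X Lc (unitS sf sm (fun κ v => cE • wilsonA d κ v)) μ u y w (Sum.inl b) (Sum.inl α)) =
      c * ∑ κ : Fin (d + 1), ∑ t ∈ U, colH X Lc μ u κ t * W κ t := by
    intro u
    have e : ∀ w, p (w α) * vertexOfK X Lc (unitS sf sm (fun κ v => cE • wilsonA d κ v)) μ u y w (Sum.inl b) (Sum.inl α) =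
        ∑ κ : Fin (d + 1), ∑ t ∈ U, c * colH X Lc μ u κ t * (p (w α) * wilsonA d κ t y w (Sum.inl b) (Sum.inl α)) := by
      intro w
      rw [vertexOfK_wilson_inl_inl', Finset.mul_sum, Finset.mul_sum]
      refine Finset.sum_congr rfl fun κ _ => ?_
      rw [Finset.mul_sum, Finset.mul_sum]
      exact Finset.sum_congr rfl fun t _ => by ring
    have hs : ∀ κ, ∀ t, Summable fun w : Site (d + 1) => c * colH X Lc μ u κ t * (p (w α) * wilsonA d κ t y w (Sum.inl b) (Sum.inl α)) := by
      intro κ t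
      refine summable_of_ne_finset_zero (s := suppW κ t) fun w hw => ?_
      rw [wilsonA_eq_zero_right κ t y hw b α]; ring
    rw [tsum_congr e, Summable.tsum_finsetSum (fun κ _ => summable_sum fun t _ => hs κ t), Finset.mul_sum]
    refine Finset.sum_congr rfl fun κ _ => ?_
    rw [Summable.tsum_finsetSum (fun t _ => hs κ t), Finset.mul_sum]
    refine Finset.sum_congr rfl fun t ht => ?_
    rw [tsum_mul_left, hWt κ t ht]
    ring
  simp_rw [step1]
  have step2 : HasSum (fun u : Site (d + 1) => c * ∑ κ : Fin (d + 1), ∑ t ∈ U, colH X Lc μ u κ t * W κ t)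
      (c * ∑ κ : Fin (d + 1), ∑ t ∈ U, (if t κ % (Lc : ℤ) = (Lc : ℤ) - 1 then ((Lc : ℝ) * (sm * sf)) *
        (if κ = μ then ((((Lc ^ (j + 1) : ℕ) : ℝ)) ^ (d + 1 + 1))⁻¹ else 0) else 0) * W κ t) := by
    refine HasSum.mul_left c (hasSum_sum fun κ _ => hasSum_sum fun t _ => ?_)
    exact (hasSum_dressedStep_col (d := d) hLc hr sf sm j μ (Sum.inl κ) t).mul_right (W κ t)
  convert step2 using 1
  rw [Finset.sum_eq_single μ (fun κ _ hκ => Finset.sum_eq_zero fun t _ => by rw [if_neg hκ]; simp) (fun h => absurd (Finset.mem_univ μ) h)]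
  simp only [if_true]
  have hval : ∑ t ∈ U, p (t μ) * W μ t = (1 / 2 : ℝ) * curvAdj (fun κ l (x : Site (d + 1)) =>
      (if κ = μ ∧ l = α then p (x μ) * p (x α) else 0) - (if κ = α ∧ l = μ then p (x μ) * p (x α) else 0)) b y := by
    have h7 := hasSum_biweighted_wilsonA_snd (d := d) hμα p p b y
    have hz : ∀ tw ∉ U ×ˢ U.biUnion (suppW μ), p (tw.1 μ) * p (tw.2 α) * wilsonA d μ tw.1 y tw.2 (Sum.inl b) (Sum.inl α) = 0 := by
      intro tw htw
      by_contra hne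
      exact htw (Finset.mem_product.2 (mem_biUnion_of_wilsonA_ne_zero_right μ (right_ne_zero_of_mul hne)))
    rw [← (hasSum_sum_of_ne_finset_zero hz).unique h7, Finset.sum_product]
    refine Finset.sum_congr rfl fun t _ => ?_
    rw [hW, Finset.mul_sum]
    exact Finset.sum_congr rfl fun w _ => by ring
  have e3 : ∀ t ∈ U, (if t μ % (Lc : ℤ) = (Lc : ℤ) - 1 then ((Lc : ℝ) * (sm * sf)) * ((((Lc ^ (j + 1) : ℕ) : ℝ)) ^ (d + 1 + 1))⁻¹ else 0) * W μ t =
      (((Lc : ℝ) * (sm * sf)) * ((((Lc ^ (j + 1) : ℕ) : ℝ)) ^ (d + 1 + 1))⁻¹) * (p (t μ) * W μ t) := by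
    intro t _
    simp only [hp]
    split_ifs <;> ring
  rw [Finset.sum_congr rfl e3, ← Finset.mul_sum, hval]
  ring

end Resummed

end Summit.QuantumFields.BalabanUV.Beta.GAN24.DressedWilsonHalfVertex

end
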